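import Mathlib
import Literature.AlgebraicGeometry.Resolution.CobordantBlowupFiltration
import Literature.AlgebraicGeometry.Resolution.ExtendedReesSaturation
import Summits.ResolutionOfSingularities.ResolutionOfSingularities.Theorems.WeightedInvariantDatumToEmbeddedAtlasAmbientGraded
import Summits.ResolutionOfSingularities.ResolutionOfSingularities.Theorems.WeightedInvariantDatumToEmbeddedAtlasAmbientRees
import HarnessLib

/-!
# The graded chart ring `(⊕ₙ Jₙ tⁿ)[1/β t^D]` of the ambient chart `D(β t^D)`

Topic: `Summits/ResolutionOfSingularities/ResolutionOfSingularities/Theorems`. Helper file of the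
stub `stub_qs_atlas_ambient` of the line `Sketch` of the crux `Theses.WeightedInvariant.DatumToEmbedded`
(statement `stmt-ResolutionOfSingularities-0572`) of the summit
`Summit.ResolutionOfSingularities.ResolutionOfSingularities`.

Ring-level content of the ambient chart `D(β t^D) ⊆ B₊` of Włodarczyk's cobordant blow-up
(arXiv:2203.03090, §2.3.3: the charts `B_{x'ᵢ} = D(xᵢ t^{wᵢ})` of `B₊` and their invariants).
For a ring `A = ⨁ᵢ Aᵢ` graded by an additive group `ι`, a filtration `F = (Jₙ)` of `A` by ideals,
the extended Rees algebra `S = ⊕ₙ Jₙ tⁿ ⊆ A[t, t⁻¹]` (`IdealFiltration.extendedRees`), a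
degree-`0` element `β ∈ J_D` and `v₀ = β t^D ∈ S`, any localisation `L = S[1/v₀]` is graded by
`ι × ℤ` (`awayPiece` of `…AtlasAmbientGraded` over `subalgebraPiece (laurentPiece 𝒜₀) S` of
`…AtlasAmbientRees`), and:

* `algebraMap_t_mem_awayPiece`, `algebraMap_self_mem_awayPiece`,
  `algebraMap_algebraMap_mem_awayPiece` — `t⁻¹/1`, `v₀/1`, `a/1` (`a ∈ Aᵢ`) are homogeneous of
  degrees `(0, -1)`, `(0, D)`, `(i, 0)`;
* `exists_of_mem_awayPiece_zero`, `exists_mem_awayPiece_zero` — **the degree-`(0,0)` part of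
  `L` consists of the `x t^{Dl} / v₀ˡ`, `x ∈ J_{Dl} ∩ A₀`**;
* `isUnit_algebraMap_of_mul_t_pow_eq` — if `u (t⁻¹)^D = β` with `u` a unit of some `S[1/g]`
  then `v₀` is a unit there (`t⁻¹` is a non-zero-divisor);
* `exists_mul_pow_mem` — **contraction**: if `(t⁻¹)ⁿ x ∈ I · L` for `x ∈ A` and an ideal
  `I ⊆ A`, then `x βᴹ ∈ I` for some `M` (clear denominators and read off one Laurent
  coefficient, `IdealFiltration.coeff_mem_of_mem_map`);
* `isHomogeneous_iSup_colon_map` — for `I` homogeneous, the saturation `⋃ₙ (I L : (t⁻¹)ⁿ)`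
  (the strict transform of `V(I)` on the chart) is a homogeneous ideal of `L`.

Only Mathlib, the two `AtlasAmbient` helper files and `ExtendedReesSaturation.lean` are used; no
definitions.
-/

-- the summit namespace repeats `ResolutionOfSingularities` by design (mandated namespace)
set_option linter.dupNamespace false

namespace Summit.ResolutionOfSingularities.ResolutionOfSingularities.Theorems.DatumToEmbedded.AtlasAmbient

open scoped LaurentPolynomial
open LaurentPolynomial DirectSum Literature.AlgebraicGeometry.Resolution

/-! ## Images of homogeneous ideals along degree-changing maps -/

section MapOfForall

variable {κ κ' A B σ τ : Type*} [CommRing A] [CommRing B] [SetLike σ A] [AddSubmonoidClass σ A]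
  [SetLike τ B] [AddSubmonoidClass τ B] (𝒜 : κ → σ) (ℬ : κ' → τ)

/-- **The extension of a homogeneous ideal along a ring map sending homogeneous elements to
homogeneous elements (of possibly re-indexed degrees) is homogeneous.** [folklore] -/
theorem isHomogeneous_map_of_forall' [DecidableEq κ] [AddMonoid κ] [GradedRing 𝒜]
    [DecidableEq κ'] [AddMonoid κ'] [GradedRing ℬ] (f : A →+* B)
    (hf : ∀ (i : κ) (x : A), x ∈ 𝒜 i → SetLike.IsHomogeneousElem ℬ (f x)) {I : Ideal A}
    (hI : I.IsHomogeneous 𝒜) : (I.map f).IsHomogeneous ℬ := by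
  obtain ⟨T, rfl⟩ := (Ideal.IsHomogeneous.iff_exists 𝒜 _).mp hI
  rw [Ideal.map_span]
  refine Ideal.homogeneous_span _ _ ?_
  rintro _ ⟨_, ⟨t, _, rfl⟩, rfl⟩
  obtain ⟨i, hi⟩ := t.2
  exact hf i _ hi

end MapOfForall

/-! ## Homogeneous elements of the extended Rees algebra -/

section Rees

variable {ι A : Type*} [CommRing A] (𝒜₀ : ι → Submodule ℤ A) (F : IdealFiltration A)

/-- An element `a tⁿ` of `⊕ₙ Jₙ tⁿ` with `a ∈ Aᵢ` is homogeneous of degree `(i, n)`. [folklore] -/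
theorem mem_subalgebraPiece_of_coe_eq {i : ι} {a : A} (ha : a ∈ 𝒜₀ i) (n : ℤ)
    (x : F.extendedRees) (hx : (x : A[T;T⁻¹]) = C a * T n) :
    x ∈ subalgebraPiece (laurentPiece 𝒜₀) F.extendedRees (i, n) :=
  mem_subalgebraPiece_iff.2 (hx ▸ C_mul_T_mem_laurentPiece ha n)

/-- `a t⁰ ∈ ⊕ₙ Jₙ tⁿ` is homogeneous of degree `(i, 0)` for `a ∈ Aᵢ`. [folklore] -/
theorem algebraMap_mem_subalgebraPiece {i : ι} {a : A} (ha : a ∈ 𝒜₀ i) :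
    algebraMap A F.extendedRees a ∈ subalgebraPiece (laurentPiece 𝒜₀) F.extendedRees (i, 0) :=
  mem_subalgebraPiece_iff.2 (coe_algebraMap_mem_laurentPiece ha)

/-- `t⁻¹ ∈ ⊕ₙ Jₙ tⁿ` is homogeneous of degree `(0, -1)`. [folklore] -/
theorem t_mem_subalgebraPiece [AddCommMonoid ι] [SetLike.GradedMonoid 𝒜₀] :
    (⟨T (-1), F.T_neg_one_mem_extendedRees⟩ : F.extendedRees) ∈
      subalgebraPiece (laurentPiece 𝒜₀) F.extendedRees ((0 : ι), (-1 : ℤ)) :=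
  mem_subalgebraPiece_iff.2 T_neg_one_mem_laurentPiece

end Rees

/-! ## The graded localisation `(⊕ₙ Jₙ tⁿ)[1/β t^D]` -/

section Local

variable {ι A : Type*} [AddCommGroup ι] [DecidableEq ι] [CommRing A] (𝒜₀ : ι → Submodule ℤ A)
  (F : IdealFiltration A) [GradedRing (subalgebraPiece (laurentPiece 𝒜₀) F.extendedRees)]
  (L : Type*) [CommRing L] [Algebra F.extendedRees L]
  {v₀ : F.extendedRees} {Dg : ℕ} {β : A}
  (hv₀ : v₀ ∈ subalgebraPiece (laurentPiece 𝒜₀) F.extendedRees ((0 : ι), (Dg : ℤ)))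
  (hv : (v₀ : A[T;T⁻¹]) = C β * T (Dg : ℤ))

/-- `t⁻¹ / 1` is homogeneous of degree `(0, -1)`. [folklore] -/
theorem algebraMap_t_mem_awayPiece [SetLike.GradedMonoid 𝒜₀] :
    algebraMap F.extendedRees L ⟨T (-1), F.T_neg_one_mem_extendedRees⟩ ∈
      awayPiece (subalgebraPiece (laurentPiece 𝒜₀) F.extendedRees) hv₀ L ((0 : ι), (-1 : ℤ)) :=
  algebraMap_mem_awayPiece hv₀ (t_mem_subalgebraPiece 𝒜₀ F)

/-- `v₀ / 1` is homogeneous of degree `(0, D)`. [folklore] -/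
theorem algebraMap_self_mem_awayPiece :
    algebraMap F.extendedRees L v₀ ∈
      awayPiece (subalgebraPiece (laurentPiece 𝒜₀) F.extendedRees) hv₀ L ((0 : ι), (Dg : ℤ)) :=
  algebraMap_mem_awayPiece hv₀ hv₀

/-- `a / 1` is homogeneous of degree `(i, 0)` for `a ∈ Aᵢ`. [folklore] -/
theorem algebraMap_algebraMap_mem_awayPiece {i : ι} {a : A} (ha : a ∈ 𝒜₀ i) :
    algebraMap F.extendedRees L (algebraMap A F.extendedRees a) ∈
      awayPiece (subalgebraPiece (laurentPiece 𝒜₀) F.extendedRees) hv₀ L (i, 0) :=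
  algebraMap_mem_awayPiece hv₀ (algebraMap_mem_subalgebraPiece 𝒜₀ F ha)

omit [AddCommGroup ι] [DecidableEq ι]
  [GradedRing (subalgebraPiece (laurentPiece 𝒜₀) F.extendedRees)] in
include hv in
/-- **`v₀ · (t⁻¹)^D = β`** in the localisation. [folklore] -/
theorem algebraMap_mul_t_pow :
    algebraMap F.extendedRees L v₀ *
        algebraMap F.extendedRees L ⟨T (-1), F.T_neg_one_mem_extendedRees⟩ ^ Dg =
      algebraMap F.extendedRees L (algebraMap A F.extendedRees β) := by
  rw [← map_pow, ← map_mul, mul_t_pow_eq_algebraMap F ⟨T (-1), F.T_neg_one_mem_extendedRees⟩ rfl v₀ hv]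

omit [DecidableEq ι] [GradedRing (subalgebraPiece (laurentPiece 𝒜₀) F.extendedRees)] in
/-- The degree `0 + l · (0, D) = (0, D l)`. [folklore] -/
theorem zero_add_nsmul_eq (l : ℕ) :
    (0 : ι × ℤ) + l • ((0 : ι), (Dg : ℤ)) = ((0 : ι), ((Dg * l : ℕ) : ℤ)) := by
  rw [zero_add, show ((0 : ι), (Dg : ℤ)) = AddMonoidHom.inr ι ℤ (Dg : ℤ) from rfl, ← map_nsmul,
    AddMonoidHom.inr_apply, nsmul_eq_mul, Nat.cast_mul, mul_comm]

/-- **Degree-`(0,0)` elements of `(⊕ₙ Jₙ tⁿ)[1/β t^D]` are the `x t^{Dl} / (β t^D)ˡ`** with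
`x ∈ J_{Dl} ∩ A₀`: precisely, `s · v₀ˡ · (t⁻¹)^{Dl} = x` for such an `x`. [cite: Wlodarczyk2022, §2.3.3] -/
theorem exists_of_mem_awayPiece_zero {s : L}
    (hs : s ∈ awayPiece (subalgebraPiece (laurentPiece 𝒜₀) F.extendedRees) hv₀ L 0) :
    ∃ (l : ℕ) (x₀ : A), x₀ ∈ F.ideal (Dg * l) ∧ x₀ ∈ 𝒜₀ 0 ∧
      s * algebraMap F.extendedRees L v₀ ^ l *
          algebraMap F.extendedRees L ⟨T (-1), F.T_neg_one_mem_extendedRees⟩ ^ (Dg * l) =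
        algebraMap F.extendedRees L (algebraMap A F.extendedRees x₀) := by
  obtain ⟨l, y, hy, hsy⟩ := (mem_awayPiece_iff hv₀).1 hs
  rw [zero_add_nsmul_eq] at hy
  exact ⟨l, exists_of_pow_mul_eq 𝒜₀ F ⟨T (-1), F.T_neg_one_mem_extendedRees⟩ rfl L v₀ (mem_subalgebraPiece_iff.1 hy) hsy⟩

/-- … and conversely every `x ∈ J_{Dl} ∩ A₀` arises from a degree-`(0,0)` element.
[cite: Wlodarczyk2022, §2.3.3] -/
theorem exists_mem_awayPiece_zero [IsLocalization.Away v₀ L] (l : ℕ) {x₀ : A}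
    (hJ : x₀ ∈ F.ideal (Dg * l)) (h0 : x₀ ∈ 𝒜₀ 0) :
    ∃ s ∈ awayPiece (subalgebraPiece (laurentPiece 𝒜₀) F.extendedRees) hv₀ L 0,
      s * algebraMap F.extendedRees L v₀ ^ l *
          algebraMap F.extendedRees L ⟨T (-1), F.T_neg_one_mem_extendedRees⟩ ^ (Dg * l) =
        algebraMap F.extendedRees L (algebraMap A F.extendedRees x₀) := by
  let y : F.extendedRees := ⟨C x₀ * T ((Dg * l : ℕ) : ℤ), F.C_mul_T_mem_extendedRees_iff.mpr hJ⟩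
  obtain ⟨s, hs, hs'⟩ := exists_pow_mul_eq F ⟨T (-1), F.T_neg_one_mem_extendedRees⟩ rfl L v₀ (Dg := Dg) (l := l) y rfl
  refine ⟨s, (mem_awayPiece_iff hv₀).2 ⟨l, y, ?_, hs⟩, hs'⟩
  rw [zero_add_nsmul_eq]
  exact mem_subalgebraPiece_of_coe_eq 𝒜₀ F h0 _ y rfl

omit [AddCommGroup ι] [DecidableEq ι]
  [GradedRing (subalgebraPiece (laurentPiece 𝒜₀) F.extendedRees)] in
include hv in
/-- **`D(β t^D)` is where `β = (t⁻¹)^D · unit`**: if in some localisation `(⊕ₙ Jₙ tⁿ)[1/g]` a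
unit `u` satisfies `u (t⁻¹)^D = β`, then `v₀ = β t^D` is a unit there (`u = v₀`, as `t⁻¹` is a
non-zero-divisor). [cite: Wlodarczyk2022, §2.3.3] -/
theorem isUnit_algebraMap_of_mul_t_pow_eq (Lg : Type*) [CommRing Lg] [Algebra F.extendedRees Lg]
    (g : F.extendedRees) [IsLocalization.Away g Lg] {u : Lg} (hu : IsUnit u)
    (h : u * algebraMap F.extendedRees Lg ⟨T (-1), F.T_neg_one_mem_extendedRees⟩ ^ Dg =
      algebraMap F.extendedRees Lg (algebraMap A F.extendedRees β)) :
    IsUnit (algebraMap F.extendedRees Lg v₀) := by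
  rwa [← eq_algebraMap_of_mul_t_pow_eq F ⟨T (-1), F.T_neg_one_mem_extendedRees⟩ rfl Lg g v₀ hv h]

omit [AddCommGroup ι] [DecidableEq ι]
  [GradedRing (subalgebraPiece (laurentPiece 𝒜₀) F.extendedRees)] in
include hv in
/-- Powers of `v₀ = β t^D` are `βᴹ t^{DM}`. [folklore] -/
theorem coe_self_pow (M : ℕ) :
    ((v₀ ^ M : F.extendedRees) : A[T;T⁻¹]) = C (β ^ M) * T ((Dg * M : ℕ) : ℤ) := by
  rw [SubmonoidClass.coe_pow, hv, mul_pow, ← map_pow, T_pow, Nat.cast_mul, mul_comm (Dg : ℤ)]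

omit [AddCommGroup ι] [DecidableEq ι]
  [GradedRing (subalgebraPiece (laurentPiece 𝒜₀) F.extendedRees)] in
include hv in
/-- **Contraction to `A` along the chart `D(β t^D)`**: if `(t⁻¹)ⁿ · x ∈ I · (⊕ₙ Jₙ tⁿ)[1/β t^D]`
for `x ∈ A` and an ideal `I ⊆ A`, then `x βᴹ ∈ I` for some `M` — clear the denominator `v₀ᵐ`,
multiply by `(t⁻¹)^{DM}` to land on `(t⁻¹)ⁿ · x βᴹ ∈ I · ⊕ₙ Jₙ tⁿ`, all of whose Laurent
coefficients lie in `I`. [cite: Wlodarczyk2022, §2.3.3] -/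
theorem exists_mul_pow_mem [IsLocalization.Away v₀ L] {I : Ideal A} {x : A} {n : ℕ}
    (h : algebraMap F.extendedRees L ⟨T (-1), F.T_neg_one_mem_extendedRees⟩ ^ n *
        algebraMap F.extendedRees L (algebraMap A F.extendedRees x) ∈
      (I.map (algebraMap A F.extendedRees)).map (algebraMap F.extendedRees L)) :
    ∃ M : ℕ, x * β ^ M ∈ I := by
  rw [← map_pow, ← map_mul, IsLocalization.mem_map_algebraMap_iff (Submonoid.powers v₀) L] at h
  obtain ⟨⟨⟨y, hy⟩, ⟨_, m, rfl⟩⟩, h⟩ := h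
  rw [← map_mul, IsLocalization.eq_iff_exists (Submonoid.powers v₀) L] at h
  obtain ⟨⟨_, m', rfl⟩, h⟩ := h
  have hkey : (⟨T (-1), F.T_neg_one_mem_extendedRees⟩ : F.extendedRees) ^ n *
      algebraMap A F.extendedRees (x * β ^ (m + m')) ∈ I.map (algebraMap A F.extendedRees) := by
    have h1 : (⟨T (-1), F.T_neg_one_mem_extendedRees⟩ : F.extendedRees) ^ n *
        algebraMap A F.extendedRees (x * β ^ (m + m')) =
        v₀ ^ m' * ((⟨T (-1), F.T_neg_one_mem_extendedRees⟩ : F.extendedRees) ^ n *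
          algebraMap A F.extendedRees x * v₀ ^ m) *
          (⟨T (-1), F.T_neg_one_mem_extendedRees⟩ : F.extendedRees) ^ (Dg * (m + m')) := by
      rw [map_mul, ← mul_t_pow_eq_algebraMap F ⟨T (-1), F.T_neg_one_mem_extendedRees⟩ rfl (v₀ ^ (m + m')) (coe_self_pow F hv (m + m'))]
      ring
    rw [h1]
    refine Ideal.mul_mem_right _ _ ?_
    rw [h]
    exact Ideal.mul_mem_left _ _ hy
  refine ⟨m + m', ?_⟩
  have hc := IdealFiltration.coeff_mem_of_mem_map F I hkey (-n)
  rwa [IdealFiltration.coeff_T_neg_one_pow_mul, neg_add_cancel, Subalgebra.coe_algebraMap,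
    ← C_eq_algebraMap, ← single_eq_C, AddMonoidAlgebra.coeff_single, Finsupp.single_eq_same] at hc

/-- **The strict transform ideal on the chart is homogeneous**: for a homogeneous ideal `I ⊆ A`
the saturation `⋃ₙ (I · L : (t⁻¹/1)ⁿ)` is homogeneous for the grading of
`L = (⊕ₙ Jₙ tⁿ)[1/β t^D]` (and any graded-ring structure on its pieces). [cite: Wlodarczyk2022, §2.3.3] -/
theorem isHomogeneous_iSup_colon_map [GradedRing 𝒜₀]
    [GradedRing (awayPiece (subalgebraPiece (laurentPiece 𝒜₀) F.extendedRees) hv₀ L)]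
    {I : Ideal A} (hI : I.IsHomogeneous 𝒜₀) :
    (⨆ n : ℕ, ((I.map ((algebraMap F.extendedRees L).comp (algebraMap A F.extendedRees))).colon
      ((Ideal.span {algebraMap F.extendedRees L ⟨T (-1), F.T_neg_one_mem_extendedRees⟩} ^ n :
        Ideal L) : Set L))).IsHomogeneous
      (awayPiece (subalgebraPiece (laurentPiece 𝒜₀) F.extendedRees) hv₀ L) := by
  rw [← Ideal.map_map]
  refine isHomogeneous_iSup_colon _ (algebraMap_t_mem_awayPiece 𝒜₀ F L hv₀) ?_
  refine isHomogeneous_map_algebraMap _ hv₀ L ?_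
  exact isHomogeneous_map_of_forall' 𝒜₀ (subalgebraPiece (laurentPiece 𝒜₀) F.extendedRees)
    (algebraMap A F.extendedRees) (fun i a ha => ⟨(i, 0), algebraMap_mem_subalgebraPiece 𝒜₀ F ha⟩) hI

end Local

/-! ## Registered form -/

/-- **Registered sub-goal `stub_qs_atlasAmbientLocal`** of the crux (helper of the stub
`stub_qs_atlas_ambient`): contraction along the chart `D(β t^D)` — if
`(t⁻¹)ⁿ x ∈ I · (⊕ₙ Jₙ tⁿ)[1/β t^D]` for `x ∈ A` and an ideal `I ⊆ A`, then `x βᴹ ∈ I` for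
some `M`. [cite: Wlodarczyk2022, §2.3.3] -/
theorem stub_qs_atlasAmbientLocal :
    ∀ {A : Type} [CommRing A] (F : Literature.AlgebraicGeometry.Resolution.IdealFiltration A)
      (L : Type) [CommRing L] [Algebra F.extendedRees L] (v₀ : F.extendedRees) (Dg : ℕ) (β : A),
      (v₀ : LaurentPolynomial A) = LaurentPolynomial.C β * LaurentPolynomial.T (Dg : ℤ) →
      ∀ [IsLocalization.Away v₀ L] (I : Ideal A) (x : A) (n : ℕ),
      algebraMap F.extendedRees L ⟨LaurentPolynomial.T (-1), F.T_neg_one_mem_extendedRees⟩ ^ n *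
          algebraMap F.extendedRees L (algebraMap A F.extendedRees x) ∈
        (I.map (algebraMap A F.extendedRees)).map (algebraMap F.extendedRees L) →
      ∃ M : ℕ, x * β ^ M ∈ I :=
  fun F L _ _ _ _ _ hv _ _ _ _ h => exists_mul_pow_mem F L hv h

end Summit.ResolutionOfSingularities.ResolutionOfSingularities.Theorems.DatumToEmbedded.AtlasAmbient
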